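import Summits.CriticalPhenomena.PercolationContinuityZ3.Theorems.PercNearOneGluingNoHeavyLowerTailSahiThreeChainSlotCertificate
import Summits.CriticalPhenomena.PercolationContinuityZ3.Theorems.PercNearOneGluingNoHeavyLowerTailSahiThreeChainSlotForm

/-!
# Sahi's `C₃` in dimension three, III-a: the certificate quantity `slotPhi` IS the slot form `T` on cell sets (bit plumbing)

Support file of the one-cut programme (crux `NoHeavyLowerTail`, stmt-CriticalPhenomena-4575; cell `prim-masterthm`, seat P3, gen 17;
`run/shared/lean/prim/prim-masterthm/prim-masterthm-p3/HIERARCHY.md` §25; memo `run/shared/lean/prim/prim-masterthm/FROM-prim-masterthm-p3-g17-THREE-CHAINS-C3.md`).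

The kernel certificate `…SahiThreeChainSlotCertificate` evaluates the bit-mask potential form `SahiThreeChain.slotPhi`; the assembly `…SahiThreeChainOrderThree`
needs the slot form `SahiThreeChain.T` of `…SahiThreeChainSlotForm` on indicator triples.  This file identifies the two:
* `bit m j ∈ {0,1}`; `pc27_eq` (the table popcount is `Σ_{j<27} bit m j` — one `native_decide` for the `512`-entry table); `bit_land`; the cell code
  `code : P → ℕ` with `sum_range_code` (reindexing `range 27` by cells); `bit_ncMask` (the non-conflict masks ARE the non-attacking relation, `native_decide`);
* `cellSet m = {z | bit m (code z) = 1}` and **`slotPhi_eq_T` : `(slotPhi U V W : ℝ) = T (setInd (cellSet U)) (setInd (cellSet V)) (setInd (cellSet W))`** for ALL masks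
  (the potential form is the fibre decomposition of the pair/triple counts over the third member — a polynomial identity in the bits).
HONEST LABEL: proved; two small `native_decide` table evaluations (proposed `--computational`); axioms standard + `Lean.ofReduceBool`. [this work]
-/

namespace Summit.CriticalPhenomena.PercolationContinuityZ3.Theorems

namespace SahiThreeChain

open Finset Function
open Literature.Combinatorics.Sahi2008

/-! ### Bits and the table popcount -/

/-- The `0/1` value of bit `j` of `m`, as an integer. [this work] -/
def bit (m j : ℕ) : ℤ := if Nat.testBit m j then 1 else 0

/-- `bit` of an AND is the product. [this work] -/
theorem bit_land (a b j : ℕ) : bit (a &&& b) j = bit a j * bit b j := by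
  unfold bit
  rw [Nat.testBit_land]
  cases Nat.testBit a j <;> cases Nat.testBit b j <;> simp

/-- The `512`-entry popcount table is correct: `pcTab[k] = Σ_{j<9} bit k j`. [this work] -/
theorem pcTab_getD (k : Fin 512) : (pcTab.getD k 0 : ℤ) = ∑ j ∈ Finset.range 9, bit k j := by
  revert k
  native_decide

/-- Low `9` bits. [this work] -/
theorem bit_land_511 (m j : ℕ) (hj : j < 9) : bit (m &&& 511) j = bit m j := by
  unfold bit
  rw [Nat.testBit_land, show (511 : ℕ) = 2 ^ 9 - 1 by norm_num, Nat.testBit_two_pow_sub_one]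
  simp [hj]

/-- Shifted bits. [this work] -/
theorem bit_shiftRight (m i j : ℕ) : bit (m >>> i) j = bit m (i + j) := by
  unfold bit
  rw [Nat.testBit_shiftRight]

/-- **The table popcount is the number of set bits below `27`.** [this work] -/
theorem pc27_eq (m : ℕ) : (pc27 pcTab m : ℤ) = ∑ j ∈ Finset.range 27, bit m j := by
  unfold pc27
  have h1 : ∀ x : ℕ, (pcTab.getD (x &&& 511) 0 : ℤ) = ∑ j ∈ Finset.range 9, bit (x &&& 511) j := by
    intro x
    have hlt : x &&& 511 < 512 := Nat.lt_succ_of_le Nat.and_le_right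
    exact pcTab_getD ⟨x &&& 511, hlt⟩
  push_cast
  rw [h1, h1, h1]
  have e1 : ∑ j ∈ Finset.range 9, bit (m &&& 511) j = ∑ j ∈ Finset.range 9, bit m j :=
    Finset.sum_congr rfl fun j hj => bit_land_511 m j (Finset.mem_range.1 hj)
  have e2 : ∑ j ∈ Finset.range 9, bit (m >>> 9 &&& 511) j = ∑ j ∈ Finset.range 9, bit m (9 + j) :=
    Finset.sum_congr rfl fun j hj => by rw [bit_land_511 _ j (Finset.mem_range.1 hj), bit_shiftRight]
  have e3 : ∑ j ∈ Finset.range 9, bit (m >>> 18 &&& 511) j = ∑ j ∈ Finset.range 9, bit m (18 + j) :=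
    Finset.sum_congr rfl fun j hj => by rw [bit_land_511 _ j (Finset.mem_range.1 hj), bit_shiftRight]
  rw [e1, e2, e3]
  rw [show (27 : ℕ) = 9 + 9 + 9 by norm_num, Finset.sum_range_add, Finset.sum_range_add]

/-! ### Cells and codes -/

/-- The code `9x + 3y + z` of a cell. [this work] -/
def code (z : P) : ℕ := 9 * z.1.val + 3 * z.2.1.val + z.2.2.val

/-- The code as an element of `Fin 27`. [this work] -/
def codeFin (z : P) : Fin 27 := ⟨code z, by unfold code; omega⟩

/-- Decoding. [this work] -/
def decFin (j : Fin 27) : P := (⟨j.val / 9, by omega⟩, ⟨(j.val / 3) % 3, by omega⟩, ⟨j.val % 3, by omega⟩)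

/-- `code` is a bijection `P ≃ Fin 27`. [this work] -/
def codeEquiv : P ≃ Fin 27 where
  toFun := codeFin
  invFun := decFin
  left_inv := by intro z; revert z; decide
  right_inv := by intro j; revert j; decide

/-- Reindexing a sum over `range 27` by the cells. [this work] -/
theorem sum_range_code (F : ℕ → ℤ) : ∑ j ∈ Finset.range 27, F j = ∑ z : P, F (code z) := by
  rw [Finset.sum_range (n := 27) (f := F), ← Equiv.sum_comp codeEquiv]
  rfl

/-- The bits of the non-conflict mask of a cell are the non-attacking relation. [this work] -/
theorem bit_ncMask (w z : P) : bit (ncMask (code w)) (code z) = (if NonAtt z w then 1 else 0 : ℤ) := by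
  have h : ∀ w z : P, Nat.testBit (ncMask (code w)) (code z) = decide (NonAtt z w) := by
    intro w z; revert w z; native_decide
  unfold bit
  rw [h]
  by_cases hzw : NonAtt z w <;> simp [hzw]

/-- The table of non-conflict masks. [this work] -/
theorem ncTab_getD (w : P) : ncTab.getD (code w) 0 = ncMask (code w) := by
  have h : ∀ j : Fin 27, ncTab.getD j 0 = ncMask j := by intro j; revert j; native_decide
  exact h (codeFin w)

/-- The cell set of a mask. [this work] -/
def cellSet (m : ℕ) : Finset P := univ.filter fun z => Nat.testBit m (code z)

/-- The indicator of the cell set is the bit, as a real. [this work] -/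
theorem setInd_cellSet (m : ℕ) (z : P) : setInd (cellSet m) z = (bit m (code z) : ℝ) := by
  unfold setInd cellSet bit
  by_cases h : Nat.testBit m (code z) <;> simp [h]

/-- The `0/1` weight `nw` as the cast of the integer indicator. [this work] -/
theorem nw_eq_cast (z z' : P) : nw z z' = ((if NonAtt z z' then 1 else 0 : ℤ) : ℝ) := by
  unfold nw
  by_cases h : NonAtt z z' <;> simp [h]

/-- `NonAtt` is symmetric. [this work] -/
theorem nonAtt_comm (z z' : P) : NonAtt z z' ↔ NonAtt z' z := by
  unfold NonAtt
  exact ⟨fun ⟨a, b, c⟩ => ⟨Ne.symm a, Ne.symm b, Ne.symm c⟩, fun ⟨a, b, c⟩ => ⟨Ne.symm a, Ne.symm b, Ne.symm c⟩⟩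

/-! ### Unfolding the certificate's list operations -/

/-- `sumCells` is a list sum. [this work] -/
theorem sumCells_eq (l : List ℕ) (A : Array ℤ) (acc : ℤ) : sumCells l A acc = acc + (l.map fun w => A.getD w 0).sum := by
  induction l generalizing acc with
  | nil => simp [sumCells]
  | cons w ws ih => rw [sumCells, ih]; simp [add_assoc]

/-- `sumPc` is a list sum. [this work] -/
theorem sumPc_eq (pcT : Array ℕ) (V' : ℕ) (ncT : Array ℕ) (l : List ℕ) (acc : ℤ) :
    sumPc pcT V' ncT l acc = acc + (l.map fun i => (pc27 pcT (V' &&& ncT.getD i 0) : ℤ)).sum := by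
  induction l generalizing acc with
  | nil => simp [sumPc]
  | cons i is ih => rw [sumPc, ih]; simp [add_assoc]

/-- A sum over the cells of a mask is a bit-weighted sum over `range 27`. [this work] -/
theorem sum_cellsOf (m : ℕ) (F : ℕ → ℤ) : ((cellsOf m).map F).sum = ∑ j ∈ Finset.range 27, bit m j * F j := by
  unfold cellsOf bit
  rw [← List.sum_toFinset _ ((List.nodup_range).filter _), List.toFinset_filter, List.toFinset_range, Finset.sum_filter]
  refine Finset.sum_congr rfl fun j _ => ?_
  by_cases h : Nat.testBit m j <;> simp [h]

/-- Reading the potential array. [this work] -/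
theorem potArr_getD (ncT pcT : Array ℕ) (U V : ℕ) (w : P) : (potArr ncT pcT U V).getD (code w) 0 = pot ncT pcT U V (codeFin w) := by
  unfold potArr
  have hw : code w < 27 := (codeFin w).isLt
  simp [Array.getD, hw, codeFin]

/-! ### The identification `slotPhi = T` on cell sets -/

/-- The potential at a cell, in bits. [this work] -/
theorem pot_eq (U V : ℕ) (w : P) : pot ncTab pcTab U V (codeFin w) =
    16 * (bit U (code w) * bit V (code w))
    - ∑ z : P, bit U (code z) * bit V (code z) * bit (ncMask (code w)) (code z)
    - bit U (code w) * ∑ z : P, bit V (code z) * bit (ncMask (code w)) (code z)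
    - bit V (code w) * ∑ z : P, bit U (code z) * bit (ncMask (code w)) (code z)
    + ∑ i : P, bit U (code i) * bit (ncMask (code w)) (code i) *
        ∑ z : P, bit V (code z) * bit (ncMask (code w)) (code z) * bit (ncMask (code i)) (code z) := by
  have hcode : ((codeFin w : Fin 27) : ℕ) = code w := rfl
  unfold pot
  simp only [hcode, ncTab_getD]
  rw [sumPc_eq, pc27_eq, pc27_eq, pc27_eq, zero_add, sum_cellsOf]
  simp only [bit_land, pc27_eq, sum_range_code, ncTab_getD]
  have hU : (Nat.testBit U (code w) : Bool) = true ↔ bit U (code w) = 1 := by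
    unfold bit; by_cases h : Nat.testBit U (code w) <;> simp [h]
  -- replace the Boolean tests by bits
  have eU : (if (Nat.testBit U (code w) && Nat.testBit V (code w)) = true then (16 : ℤ) else 0) = 16 * (bit U (code w) * bit V (code w)) := by
    unfold bit; cases Nat.testBit U (code w) <;> cases Nat.testBit V (code w) <;> simp
  have e2 : (if Nat.testBit U (code w) = true then (∑ z : P, bit V (code z) * bit (ncMask (code w)) (code z) : ℤ) else 0) =
      bit U (code w) * ∑ z : P, bit V (code z) * bit (ncMask (code w)) (code z) := by
    unfold bit; cases Nat.testBit U (code w) <;> simp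
  have e3 : (if Nat.testBit V (code w) = true then (∑ z : P, bit U (code z) * bit (ncMask (code w)) (code z) : ℤ) else 0) =
      bit V (code w) * ∑ z : P, bit U (code z) * bit (ncMask (code w)) (code z) := by
    unfold bit; cases Nat.testBit V (code w) <;> simp
  rw [eU, e2, e3]

/-- The `0/1` integer weight of a non-attacking ordered pair. [this work] -/
def nz (z z' : P) : ℤ := if NonAtt z z' then 1 else 0

/-- `nz` is symmetric. [this work] -/
theorem nz_comm (z z' : P) : nz z z' = nz z' z := by
  unfold nz
  rw [if_congr (nonAtt_comm z z') rfl rfl]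

/-- The bits of the non-conflict masks, as `nz`. [this work] -/
theorem bit_ncMask' (w z : P) : bit (ncMask (code w)) (code z) = nz z w := bit_ncMask w z

/-- The slot form over the cells with `0/1` integer bits (the integer `Φ` of the memo). [this work] -/
def TZ (U V W : ℕ) : ℤ :=
  16 * (∑ z : P, bit U (code z) * bit V (code z) * bit W (code z))
  - (∑ z : P, ∑ z' : P, nz z z' * (bit U (code z) * bit V (code z) * bit W (code z') +
      bit U (code z) * bit W (code z) * bit V (code z') + bit V (code z) * bit W (code z) * bit U (code z')))
  + ∑ z : P, ∑ z' : P, ∑ z'' : P, nz z z' * nz z z'' * nz z' z'' * (bit U (code z) * bit V (code z') * bit W (code z''))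

/-- **The certificate quantity is the integer slot form**: `slotPhi U V W = TZ U V W` for all masks. [this work] -/
theorem slotPhi_eq_TZ (U V W : ℕ) : slotPhi U V W = TZ U V W := by
  -- unfold the list machinery of the certificate
  have h0 : slotPhi U V W = ∑ w : P, bit W (code w) * pot ncTab pcTab U V (codeFin w) := by
    unfold slotPhi sumPot
    rw [sumCells_eq, zero_add, sum_cellsOf, sum_range_code]
    exact Fintype.sum_congr _ _ fun w => by rw [potArr_getD]
  rw [h0]
  simp_rw [pot_eq, bit_ncMask']
  -- expand and match the five groups
  have g0 : ∑ w : P, bit W (code w) * (16 * (bit U (code w) * bit V (code w))) =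
      16 * ∑ z : P, bit U (code z) * bit V (code z) * bit W (code z) := by
    rw [Finset.mul_sum]; exact Fintype.sum_congr _ _ fun z => by ring
  have g1 : ∑ w : P, bit W (code w) * ∑ z : P, bit U (code z) * bit V (code z) * nz z w =
      ∑ z : P, ∑ z' : P, nz z z' * (bit U (code z) * bit V (code z) * bit W (code z')) := by
    simp_rw [Finset.mul_sum]
    rw [Finset.sum_comm]
    exact Fintype.sum_congr _ _ fun z => Fintype.sum_congr _ _ fun w => by ring
  have g2 : ∑ w : P, bit W (code w) * (bit U (code w) * ∑ z : P, bit V (code z) * nz z w) =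
      ∑ z : P, ∑ z' : P, nz z z' * (bit U (code z) * bit W (code z) * bit V (code z')) := by
    refine Fintype.sum_congr _ _ fun w => ?_
    rw [Finset.mul_sum, Finset.mul_sum]
    exact Fintype.sum_congr _ _ fun z => by rw [nz_comm z w]; ring
  have g3 : ∑ w : P, bit W (code w) * (bit V (code w) * ∑ z : P, bit U (code z) * nz z w) =
      ∑ z : P, ∑ z' : P, nz z z' * (bit V (code z) * bit W (code z) * bit U (code z')) := by
    refine Fintype.sum_congr _ _ fun w => ?_
    rw [Finset.mul_sum, Finset.mul_sum]
    exact Fintype.sum_congr _ _ fun z => by rw [nz_comm z w]; ring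
  have g4 : ∑ w : P, bit W (code w) * ∑ i : P, bit U (code i) * nz i w * ∑ z : P, bit V (code z) * nz z w * nz z i =
      ∑ z : P, ∑ z' : P, ∑ z'' : P, nz z z' * nz z z'' * nz z' z'' * (bit U (code z) * bit V (code z') * bit W (code z'')) := by
    simp_rw [Finset.mul_sum]
    rw [Finset.sum_comm]
    refine Fintype.sum_congr _ _ fun i => ?_
    rw [Finset.sum_comm]
    refine Fintype.sum_congr _ _ fun z => Fintype.sum_congr _ _ fun w => ?_
    rw [nz_comm z i]
    ring
  have hsplit : ∀ w : P, bit W (code w) * (16 * (bit U (code w) * bit V (code w)) - ∑ z : P, bit U (code z) * bit V (code z) * nz z w -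
      bit U (code w) * ∑ z : P, bit V (code z) * nz z w - bit V (code w) * ∑ z : P, bit U (code z) * nz z w +
      ∑ i : P, bit U (code i) * nz i w * ∑ z : P, bit V (code z) * nz z w * nz z i) =
      bit W (code w) * (16 * (bit U (code w) * bit V (code w))) - bit W (code w) * ∑ z : P, bit U (code z) * bit V (code z) * nz z w -
      bit W (code w) * (bit U (code w) * ∑ z : P, bit V (code z) * nz z w) - bit W (code w) * (bit V (code w) * ∑ z : P, bit U (code z) * nz z w) +
      bit W (code w) * ∑ i : P, bit U (code i) * nz i w * ∑ z : P, bit V (code z) * nz z w * nz z i := fun w => by ring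
  simp_rw [hsplit]
  rw [Finset.sum_add_distrib, Finset.sum_sub_distrib, Finset.sum_sub_distrib, Finset.sum_sub_distrib, g0, g1, g2, g3, g4]
  unfold TZ
  have hpair : ∑ z : P, ∑ z' : P, nz z z' * (bit U (code z) * bit V (code z) * bit W (code z') +
      bit U (code z) * bit W (code z) * bit V (code z') + bit V (code z) * bit W (code z) * bit U (code z')) =
      (∑ z : P, ∑ z' : P, nz z z' * (bit U (code z) * bit V (code z) * bit W (code z'))) +
      (∑ z : P, ∑ z' : P, nz z z' * (bit U (code z) * bit W (code z) * bit V (code z'))) +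
      ∑ z : P, ∑ z' : P, nz z z' * (bit V (code z) * bit W (code z) * bit U (code z')) := by
    rw [← Finset.sum_add_distrib, ← Finset.sum_add_distrib]
    refine Fintype.sum_congr _ _ fun z => ?_
    rw [← Finset.sum_add_distrib, ← Finset.sum_add_distrib]
    exact Fintype.sum_congr _ _ fun z' => by ring
  rw [hpair]
  ring

/-- The integer slot form is the real slot form on the cell sets. [this work] -/
theorem TZ_cast (U V W : ℕ) : (TZ U V W : ℝ) = T (setInd (cellSet U)) (setInd (cellSet V)) (setInd (cellSet W)) := by
  unfold TZ T
  simp only [setInd_cellSet, nw_eq_cast, nz]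
  push_cast
  rfl

/-- **`slotPhi = T` on cell sets.** [this work] -/
theorem slotPhi_eq_T (U V W : ℕ) : (slotPhi U V W : ℝ) = T (setInd (cellSet U)) (setInd (cellSet V)) (setInd (cellSet W)) := by
  rw [slotPhi_eq_TZ, TZ_cast]

end SahiThreeChain

end Summit.CriticalPhenomena.PercolationContinuityZ3.Theorems
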